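import Summits.QuantumFields.BalabanUV.Beta.GAN24.TableDressingZeroMode
import Summits.QuantumFields.BalabanUV.Beta.GAN24.ZeroModeCoarseCount

/-!
# `BalabanUV.Beta.GAN24.FourFaceOneCov` — binder row G-an2-4 ∕ (CONV-C), W-slot CT-route (the row owner gan24-p1 g23's R1 [GAN24P1-G23-R1] l.37889 «the
# factor you get for `𝔇` on a covariant table»; leaf-02 g52's count (3) of F-leaf02-g52-1 l.37867): **THE FOUR-FACE CHARGE OF A UNIT-COVARIANT TABLE
# IS A RESIDUE-CLASS-WEIGHTED SLICE CHARGE; ON PAIRWISE-DISTINCT DIRECTION PATTERNS IT IS EXACTLY `N^{−4}` OF THE CELL CHARGE** — so `𝔇` PRESERVES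
# `zmode` there (PART 2's `zmode_tableDress_ff`: `zmode N (𝔇Y) = N⁴·fourFace_N (Y)`), and the whole defect of (W3)(b) sits on the COINCIDENT patterns

NOT IN PRINT; OUR BOOKKEEPING (G-an2-4 crux team (2), leaf prover `b2b-balaban-gan24-formalise-leaf-02`, gen 52; PART 3 of the kernel certificate of F-leaf02-g52-1;
PART 1 = `GAN24/CoProjSlotCharges`, PART 2 = `GAN24/TableDressingZeroMode`).  PRIOR ART BY NAME: unit covariance ⇒ constant slice charge ∕ the cell count
`zmode N = N^{d+1}·zmode 1` is leaf-16's `ZeroModeCoarseCount`; `card_box` is `TaylorBlockSum`'s; the summability bookkeeping is PART 2's.  HONEST FRAMING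
(cell contract, verbatim): «discharging `BetaPertH` makes Bałaban's UV stability UNCONDITIONAL — a real constructive-QFT result; it is NOT the continuum limit
and NOT the Clay problem.»  HONEST DEPENDENCY (verbatim): «continuum YM on T⁴ ⇐ BetaPertH ∧ nine spine estimates (0/9 proved); BetaPertH ⇐ (D1) ∧ (D4) ∧
CAP+tail; G-an2-4 gates asym, D1 and NE2/3/4.»  [folklore] lattice-sum ∕ residue-counting bookkeeping; generic `d`, `1 ≤ N`; 0 `def`, 0 cited facts,
0 `def … : Prop`, 0 sorry.  NO estimate of Bałaban's; discharges NOTHING of (hW, hWall) ∕ «T2Shape» ∕ «T2Drift»; 0 wall binders; NEVER «G-an2-4 closed» as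
(CONV-C); NOT D1, NOT BetaPertH, NOT continuum, NOT Clay.

## What (`Y : Tab d` with `LocStencil₂ Y C δ`, `0 < δ`, UNIT-covariant: `Y κ (u + t) κ′ (u′ + t) = shiftK (−t) (Y κ u κ′ u′)`; `1 ≤ N`)
* §1 `tsum3_face_shift` (moving the first bond to the origin turns the three face masks into residue conditions on the relative offsets),
  `sum_ite_const_eq_card_mul`, **`fourFace_eq_card_weighted`**: `Σ_{r ∈ box} Σ'_{u′} Σ'_x Σ'_z [r_κ, u′_{κ′}, x_a, z_b at faces]·Y κ (toSite r) κ′ u′ x z a′ b′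
  = Σ'_{u′} Σ'_x Σ'_z (#{r ∈ box : r_κ = N−1, (r+u′)_{κ′}, (r+x)_a, (r+z)_b at faces})·Y κ 0 κ′ u′ x z a′ b′` — a residue-class count against the slice at `0`.
* §2 the count on PAIRWISE-DISTINCT patterns: `card_filter_range_emod_succ`, `filter_box_face_eq_piFinset`, **`card_faceFilter_of_pairwise_ne`**
  (`= N^{(d+1)−4}`, every `u′ x z`; needs the four directions distinct, hence `3 ≤ d`).
* §3 **`fourFace_mul_eq_zmode_of_pairwise_ne`**: `N⁴ · (four-face sum) = zmode N Y κ κ′ a′ b′`; with PART 2: **`zmode_tableDress_eq_zmode_of_pairwise_ne`**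
  — on the pairwise-distinct patterns `𝔇` PRESERVES the field–field cell charge of a unit-covariant table (at `d = 3`: the 24 permutation patterns).
* (the COINCIDENT pattern `(κ,κ,a,a)` — `N⁴·fourFace = N²·zmode` on one-plaquette supports, the owner's R1 (N1) `9 = n²` — is the sequel
  `GAN24/FourFaceOneCovCoincident`, split off for the 400-line rule.)
-/

noncomputable section

open Finset
open scoped BigOperators
open Literature.MathematicalPhysics.QuantumFieldTheory
open Literature.MathematicalPhysics.QuantumFieldTheory.Balaban1983to89
open Literature.MathematicalPhysics.QuantumFieldTheory.Balaban1983to89.Beta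
open B12Sec2to5 (l1)
open ExpKernelCalculus (MKer shiftK)
open AffineAveraging (Form1 Site box toSite)
open OneStepResolventKernel (Fib)
open BalabanCompositeJets (LocStencil₂)
open Summit.QuantumFields.BalabanUV.Beta.AxialDressingRooted (coProjBmAtK dressKBmAt)
open Summit.QuantumFields.BalabanUV.Beta.GAN24.BiStencilZeroMode (Tab zmode)
open Summit.QuantumFields.BalabanUV.Beta.GAN24.TaylorBlockSum (card_box)
open Summit.QuantumFields.BalabanUV.Beta.GAN24.ZeroModeCoarseCount (inner_const_of_unit_cov)
open Summit.QuantumFields.BalabanUV.Beta.GAN24.TableDressingZeroMode (summable_ite_of_summable summable_triple zmode_tableDress_ff)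

namespace Summit.QuantumFields.BalabanUV.Beta.GAN24.FourFaceOneCov

variable {d : ℕ} {N : ℕ} {r : Fin (d + 1) → ℕ}

/-! ## §1 The four-face sum of a unit-covariant table as a residue-class-weighted slice charge -/

/-- [folklore] **MOVING THE FIRST BOND TO THE ORIGIN**: for a unit-covariant table, masks on the three summed positions become masks on the relative
offsets — `Σ'_{u′} Σ'_x Σ'_z [P u′ x z]·Y κ s κ′ u′ x z a′ b′ = Σ'_{u′} Σ'_x Σ'_z [P (u′+s) (x+s) (z+s)]·Y κ 0 κ′ u′ x z a′ b′` (three re-indexings by `+s`). -/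
theorem tsum3_face_shift {Y : Tab d} (h1 : ∀ κ u κ' u' t, Y κ (u + t) κ' (u' + t) = shiftK (-t) (Y κ u κ' u'))
    (P : Site (d + 1) → Site (d + 1) → Site (d + 1) → Prop) [∀ u' x z, Decidable (P u' x z)]
    (κ κ' : Fin (d + 1)) (a' b' : Fib d) (s : Site (d + 1)) :
    (∑' u' : Site (d + 1), ∑' x : Site (d + 1), ∑' z : Site (d + 1), (if P u' x z then Y κ s κ' u' x z a' b' else 0))
      = ∑' u' : Site (d + 1), ∑' x : Site (d + 1), ∑' z : Site (d + 1),
          (if P (u' + s) (x + s) (z + s) then Y κ 0 κ' u' x z a' b' else 0) := by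
  have hY : ∀ u' x z : Site (d + 1), Y κ s κ' (u' + s) (x + s) (z + s) a' b' = Y κ 0 κ' u' x z a' b' := by
    intro u' x z
    have h := h1 κ 0 κ' u' s
    rw [zero_add] at h
    rw [h]
    simp only [shiftK, add_neg_cancel_right]
  rw [← (Equiv.addRight s).tsum_eq (fun u' : Site (d + 1) => ∑' x : Site (d + 1), ∑' z : Site (d + 1),
      (if P u' x z then Y κ s κ' u' x z a' b' else 0))]
  refine tsum_congr fun u' => ?_
  simp only [Equiv.coe_addRight]
  rw [← (Equiv.addRight s).tsum_eq (fun x : Site (d + 1) => ∑' z : Site (d + 1),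
      (if P (u' + s) x z then Y κ s κ' (u' + s) x z a' b' else 0))]
  refine tsum_congr fun x => ?_
  simp only [Equiv.coe_addRight]
  rw [← (Equiv.addRight s).tsum_eq (fun z : Site (d + 1) =>
      (if P (u' + s) (x + s) z then Y κ s κ' (u' + s) (x + s) z a' b' else 0))]
  refine tsum_congr fun z => ?_
  simp only [Equiv.coe_addRight, hY]

/-- [folklore] A finite sum of copies of one value under a mask is the count of the mask times the value. -/
theorem sum_ite_const_eq_card_mul {ι : Type*} (S : Finset ι) (P : ι → Prop) [DecidablePred P] (y : ℝ) :
    ∑ i ∈ S, (if P i then y else 0) = ((S.filter P).card : ℝ) * y := by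
  rw [← Finset.sum_filter, Finset.sum_const, nsmul_eq_mul]

/-- NOT IN PRINT; OUR BOOKKEEPING.  **THE FOUR-FACE SUM OF A UNIT-COVARIANT TABLE IS A RESIDUE-CLASS COUNT AGAINST THE SLICE AT THE ORIGIN**
(`LocStencil₂ Y C δ`, `0 < δ`, unit-covariant `Y`; any face directions `κ κ′ a b`, any fibre entries `a′ b′`):
`Σ_{r ∈ box} Σ'_{u′} Σ'_x Σ'_z [(toSite r)_κ, u′_{κ′}, x_a, z_b ≡ N−1]·Y κ (toSite r) κ′ u′ x z a′ b′
 = Σ'_{u′} Σ'_x Σ'_z #{r ∈ box : (toSite r)_κ ≡ N−1, (toSite r + u′)_{κ′} ≡ N−1, (toSite r + x)_a ≡ N−1, (toSite r + z)_b ≡ N−1} · Y κ 0 κ′ u′ x z a′ b′`. -/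
theorem fourFace_eq_card_weighted (N : ℕ) {Y : Tab d} {C δ : ℝ} (hY : LocStencil₂ Y C δ) (hδ : 0 < δ)
    (h1 : ∀ κ u κ' u' t, Y κ (u + t) κ' (u' + t) = shiftK (-t) (Y κ u κ' u')) (κ κ' a b : Fin (d + 1)) (a' b' : Fib d) :
    ∑ rr ∈ box (d + 1) N, ∑' u' : Site (d + 1), ∑' x : Site (d + 1), ∑' z : Site (d + 1),
        (if toSite rr κ % (N : ℤ) = (N : ℤ) - 1 ∧ u' κ' % (N : ℤ) = (N : ℤ) - 1 ∧ x a % (N : ℤ) = (N : ℤ) - 1 ∧ z b % (N : ℤ) = (N : ℤ) - 1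
          then Y κ (toSite rr) κ' u' x z a' b' else 0)
      = ∑' u' : Site (d + 1), ∑' x : Site (d + 1), ∑' z : Site (d + 1),
        (((box (d + 1) N).filter (fun rr => toSite rr κ % (N : ℤ) = (N : ℤ) - 1 ∧ (toSite rr + u') κ' % (N : ℤ) = (N : ℤ) - 1 ∧
            (toSite rr + x) a % (N : ℤ) = (N : ℤ) - 1 ∧ (toSite rr + z) b % (N : ℤ) = (N : ℤ) - 1)).card : ℝ) * Y κ 0 κ' u' x z a' b' := by
  -- move every first bond to the origin
  have e1 : ∀ rr ∈ box (d + 1) N, (∑' u' : Site (d + 1), ∑' x : Site (d + 1), ∑' z : Site (d + 1),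
        (if toSite rr κ % (N : ℤ) = (N : ℤ) - 1 ∧ u' κ' % (N : ℤ) = (N : ℤ) - 1 ∧ x a % (N : ℤ) = (N : ℤ) - 1 ∧ z b % (N : ℤ) = (N : ℤ) - 1
          then Y κ (toSite rr) κ' u' x z a' b' else 0))
      = ∑' u' : Site (d + 1), ∑' x : Site (d + 1), ∑' z : Site (d + 1),
        (if toSite rr κ % (N : ℤ) = (N : ℤ) - 1 ∧ (u' + toSite rr) κ' % (N : ℤ) = (N : ℤ) - 1 ∧ (x + toSite rr) a % (N : ℤ) = (N : ℤ) - 1 ∧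
            (z + toSite rr) b % (N : ℤ) = (N : ℤ) - 1 then Y κ 0 κ' u' x z a' b' else 0) :=
    fun rr _ => tsum3_face_shift h1 (fun u' x z => toSite rr κ % (N : ℤ) = (N : ℤ) - 1 ∧ u' κ' % (N : ℤ) = (N : ℤ) - 1 ∧
      x a % (N : ℤ) = (N : ℤ) - 1 ∧ z b % (N : ℤ) = (N : ℤ) - 1) κ κ' a' b' (toSite rr)
  rw [Finset.sum_congr rfl e1]
  -- the masked triples at the origin are summable on the product, uniformly in the mask
  set F : (Fin (d + 1) → ℕ) → Site (d + 1) × (Site (d + 1) × Site (d + 1)) → ℝ := fun rr p =>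
    (if toSite rr κ % (N : ℤ) = (N : ℤ) - 1 ∧ (p.1 + toSite rr) κ' % (N : ℤ) = (N : ℤ) - 1 ∧ (p.2.1 + toSite rr) a % (N : ℤ) = (N : ℤ) - 1 ∧
        (p.2.2 + toSite rr) b % (N : ℤ) = (N : ℤ) - 1 then Y κ 0 κ' p.1 p.2.1 p.2.2 a' b' else 0) with hF
  have hFs : ∀ rr, Summable (F rr) := fun rr =>
    summable_ite_of_summable (summable_triple hY hδ κ 0 κ' a' b') _
  -- iterated sums ↔ product sums
  have eP : ∀ rr, (∑' u' : Site (d + 1), ∑' x : Site (d + 1), ∑' z : Site (d + 1),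
        (if toSite rr κ % (N : ℤ) = (N : ℤ) - 1 ∧ (u' + toSite rr) κ' % (N : ℤ) = (N : ℤ) - 1 ∧ (x + toSite rr) a % (N : ℤ) = (N : ℤ) - 1 ∧
            (z + toSite rr) b % (N : ℤ) = (N : ℤ) - 1 then Y κ 0 κ' u' x z a' b' else 0)) = ∑' p, F rr p := by
    intro rr
    rw [(hFs rr).tsum_prod]
    refine tsum_congr fun u' => ?_
    exact ((hFs rr).prod_factor u').tsum_prod.symm
  simp_rw [eP]
  rw [← Summable.tsum_finsetSum fun rr _ => hFs rr]
  -- the right side as a product sum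
  set G : Site (d + 1) × (Site (d + 1) × Site (d + 1)) → ℝ := fun p =>
    (((box (d + 1) N).filter (fun rr => toSite rr κ % (N : ℤ) = (N : ℤ) - 1 ∧ (toSite rr + p.1) κ' % (N : ℤ) = (N : ℤ) - 1 ∧
        (toSite rr + p.2.1) a % (N : ℤ) = (N : ℤ) - 1 ∧ (toSite rr + p.2.2) b % (N : ℤ) = (N : ℤ) - 1)).card : ℝ) *
      Y κ 0 κ' p.1 p.2.1 p.2.2 a' b' with hG
  have eFG : ∀ p, ∑ rr ∈ box (d + 1) N, F rr p = G p := by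
    intro p
    simp only [hF, hG]
    rw [← sum_ite_const_eq_card_mul]
    refine Finset.sum_congr rfl fun rr _ => ?_
    simp only [add_comm (toSite rr)]
  have hGs : Summable G := by
    have hB : ∀ p, |G p| ≤ ((box (d + 1) N).card : ℝ) * |Y κ 0 κ' p.1 p.2.1 p.2.2 a' b'| := by
      intro p
      simp only [hG, abs_mul, Nat.abs_cast]
      exact mul_le_mul_of_nonneg_right (by exact_mod_cast Finset.card_filter_le _ _) (abs_nonneg _)
    exact Summable.of_norm_bounded ((summable_triple hY hδ κ 0 κ' a' b').abs.mul_left _) fun p => by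
      rw [Real.norm_eq_abs]; exact hB p
  rw [tsum_congr eFG, hGs.tsum_prod]
  refine tsum_congr fun u' => ?_
  exact (hGs.prod_factor u').tsum_prod

/-! ## §2 The count on pairwise-distinct direction patterns -/

/-- [folklore] In `[0, N)` exactly one natural number has `(m + e) % N = N − 1` (`1 ≤ N`). -/
theorem card_filter_range_emod_succ (hN : 1 ≤ N) (e : ℤ) :
    ((Finset.range N).filter (fun m : ℕ => ((m : ℤ) + e) % (N : ℤ) = (N : ℤ) - 1)).card = 1 := by
  have hN' : (0 : ℤ) < N := by exact_mod_cast hN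
  set m₀ : ℤ := ((N : ℤ) - 1 - e) % (N : ℤ) with hm₀
  have hm₀0 : 0 ≤ m₀ := Int.emod_nonneg _ hN'.ne'
  have hm₀N : m₀ < N := Int.emod_lt_of_pos _ hN'
  rw [Finset.card_eq_one]
  refine ⟨m₀.toNat, ?_⟩
  ext m
  simp only [Finset.mem_filter, Finset.mem_range, Finset.mem_singleton]
  constructor
  · rintro ⟨hm, he⟩
    -- `m = ((m + e) − e) % N = ((N − 1) − e) % N = m₀`
    have h1 : (m : ℤ) = m₀ := by
      calc (m : ℤ) = (m : ℤ) % (N : ℤ) := (Int.emod_eq_of_lt (by omega) (by exact_mod_cast hm)).symm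
        _ = (((m : ℤ) + e) - e) % (N : ℤ) := by rw [add_sub_cancel_right]
        _ = ((((m : ℤ) + e) % (N : ℤ)) % (N : ℤ) - e % (N : ℤ)) % (N : ℤ) := by rw [Int.sub_emod, Int.emod_emod_of_dvd _ (dvd_refl _)]
        _ = ((((N : ℤ) - 1) % (N : ℤ)) - e % (N : ℤ)) % (N : ℤ) := by rw [he]
        _ = (((N : ℤ) - 1) - e) % (N : ℤ) := by rw [← Int.sub_emod]
        _ = m₀ := rfl
    omega
  · intro hm
    subst hm
    have e0 : ((m₀.toNat : ℕ) : ℤ) = m₀ := Int.toNat_of_nonneg hm₀0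
    refine ⟨by omega, ?_⟩
    rw [e0]
    calc (m₀ + e) % (N : ℤ) = ((((N : ℤ) - 1 - e) % (N : ℤ)) % (N : ℤ) + e % (N : ℤ)) % (N : ℤ) := by
            rw [hm₀, Int.add_emod, Int.emod_emod_of_dvd _ (dvd_refl _)]
      _ = (((N : ℤ) - 1 - e) + e) % (N : ℤ) := by rw [Int.emod_emod_of_dvd _ (dvd_refl _), ← Int.add_emod]
      _ = ((N : ℤ) - 1) % (N : ℤ) := by rw [sub_add_cancel]
      _ = (N : ℤ) - 1 := Int.emod_eq_of_lt (by omega) (by omega)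

/-- [folklore] … and exactly one has `m % N = N − 1` (the case `e = 0`). -/
theorem card_filter_range_emod_face (hN : 1 ≤ N) :
    ((Finset.range N).filter (fun m : ℕ => ((m : ℤ)) % (N : ℤ) = (N : ℤ) - 1)).card = 1 := by
  have h := card_filter_range_emod_succ hN 0
  simp only [add_zero] at h
  exact h

/-- [folklore] **THE FACE FILTER OF THE BOX IS A PRODUCT OF COORDINATE FILTERS** when the four directions are pairwise distinct: each coordinate is
constrained by at most one condition. -/
theorem filter_box_face_eq_piFinset (N : ℕ) {κ κ' a b : Fin (d + 1)} (hκκ' : κ ≠ κ') (hκa : κ ≠ a) (hκb : κ ≠ b) (hκ'a : κ' ≠ a) (hκ'b : κ' ≠ b)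
    (hab : a ≠ b) (u' x z : Site (d + 1)) :
    (box (d + 1) N).filter (fun rr => toSite rr κ % (N : ℤ) = (N : ℤ) - 1 ∧ (toSite rr + u') κ' % (N : ℤ) = (N : ℤ) - 1 ∧
        (toSite rr + x) a % (N : ℤ) = (N : ℤ) - 1 ∧ (toSite rr + z) b % (N : ℤ) = (N : ℤ) - 1)
      = Fintype.piFinset (fun i => (Finset.range N).filter (fun m : ℕ =>
          (i = κ → ((m : ℤ)) % (N : ℤ) = (N : ℤ) - 1) ∧ (i = κ' → ((m : ℤ) + u' κ') % (N : ℤ) = (N : ℤ) - 1) ∧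
          (i = a → ((m : ℤ) + x a) % (N : ℤ) = (N : ℤ) - 1) ∧ (i = b → ((m : ℤ) + z b) % (N : ℤ) = (N : ℤ) - 1))) := by
  ext rr
  simp only [Finset.mem_filter, AffineAveraging.box, Fintype.mem_piFinset, Finset.mem_range, toSite, Pi.add_apply]
  constructor
  · rintro ⟨hbox, h1, h2, h3, h4⟩ i
    refine ⟨hbox i, ?_, ?_, ?_, ?_⟩
    · rintro rfl; exact h1
    · rintro rfl; exact h2
    · rintro rfl; exact h3
    · rintro rfl; exact h4
  · intro h
    refine ⟨fun i => (h i).1, (h κ).2.1 rfl, (h κ').2.2.1 rfl, (h a).2.2.2.1 rfl, (h b).2.2.2.2 rfl⟩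

/-- NOT IN PRINT; OUR BOOKKEEPING.  **THE COUNT ON A PAIRWISE-DISTINCT PATTERN**: `#{r ∈ box : r_κ ≡ N−1, (r+u′)_{κ′} ≡ N−1, (r+x)_a ≡ N−1, (r+z)_b ≡ N−1} = N^{(d+1)−4}`
for EVERY `u′ x z` (`1 ≤ N`, four pairwise-distinct directions — so `3 ≤ d`): four coordinates are pinned to one residue each, the other `d − 3` are free. -/
theorem card_faceFilter_of_pairwise_ne (hN : 1 ≤ N) {κ κ' a b : Fin (d + 1)} (hκκ' : κ ≠ κ') (hκa : κ ≠ a) (hκb : κ ≠ b) (hκ'a : κ' ≠ a)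
    (hκ'b : κ' ≠ b) (hab : a ≠ b) (u' x z : Site (d + 1)) :
    ((box (d + 1) N).filter (fun rr => toSite rr κ % (N : ℤ) = (N : ℤ) - 1 ∧ (toSite rr + u') κ' % (N : ℤ) = (N : ℤ) - 1 ∧
        (toSite rr + x) a % (N : ℤ) = (N : ℤ) - 1 ∧ (toSite rr + z) b % (N : ℤ) = (N : ℤ) - 1)).card = N ^ (d + 1 - 4) := by
  rw [filter_box_face_eq_piFinset N hκκ' hκa hκb hκ'a hκ'b hab, Fintype.card_piFinset]
  -- coordinatewise cards: `1` on the four directions, `N` elsewhere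
  have hcoord : ∀ i : Fin (d + 1), ((Finset.range N).filter (fun m : ℕ =>
        (i = κ → ((m : ℤ)) % (N : ℤ) = (N : ℤ) - 1) ∧ (i = κ' → ((m : ℤ) + u' κ') % (N : ℤ) = (N : ℤ) - 1) ∧
          (i = a → ((m : ℤ) + x a) % (N : ℤ) = (N : ℤ) - 1) ∧ (i = b → ((m : ℤ) + z b) % (N : ℤ) = (N : ℤ) - 1))).card
      = if i ∈ ({κ, κ', a, b} : Finset (Fin (d + 1))) then 1 else N := by
    intro i
    by_cases hiκ : i = κ
    · subst hiκ
      rw [if_pos (by simp)]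
      have e : (Finset.range N).filter (fun m : ℕ =>
          (i = i → ((m : ℤ)) % (N : ℤ) = (N : ℤ) - 1) ∧ (i = κ' → ((m : ℤ) + u' κ') % (N : ℤ) = (N : ℤ) - 1) ∧
            (i = a → ((m : ℤ) + x a) % (N : ℤ) = (N : ℤ) - 1) ∧ (i = b → ((m : ℤ) + z b) % (N : ℤ) = (N : ℤ) - 1))
          = (Finset.range N).filter (fun m : ℕ => ((m : ℤ)) % (N : ℤ) = (N : ℤ) - 1) := by
        ext m
        simp only [Finset.mem_filter, Finset.mem_range, true_implies]
        exact ⟨fun h => ⟨h.1, h.2.1⟩, fun h => ⟨h.1, h.2, fun e => absurd e hκκ', fun e => absurd e hκa, fun e => absurd e hκb⟩⟩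
      rw [e]
      exact card_filter_range_emod_face hN
    by_cases hiκ' : i = κ'
    · subst hiκ'
      rw [if_pos (by simp)]
      have e : (Finset.range N).filter (fun m : ℕ =>
          (i = κ → ((m : ℤ)) % (N : ℤ) = (N : ℤ) - 1) ∧ (i = i → ((m : ℤ) + u' i) % (N : ℤ) = (N : ℤ) - 1) ∧
            (i = a → ((m : ℤ) + x a) % (N : ℤ) = (N : ℤ) - 1) ∧ (i = b → ((m : ℤ) + z b) % (N : ℤ) = (N : ℤ) - 1))
          = (Finset.range N).filter (fun m : ℕ => ((m : ℤ) + u' i) % (N : ℤ) = (N : ℤ) - 1) := by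
        ext m
        simp only [Finset.mem_filter, Finset.mem_range, true_implies]
        exact ⟨fun h => ⟨h.1, h.2.2.1⟩, fun h => ⟨h.1, fun e => absurd e hiκ, h.2, fun e => absurd e hκ'a, fun e => absurd e hκ'b⟩⟩
      rw [e]
      exact card_filter_range_emod_succ hN (u' i)
    by_cases hia : i = a
    · subst hia
      rw [if_pos (by simp)]
      have e : (Finset.range N).filter (fun m : ℕ =>
          (i = κ → ((m : ℤ)) % (N : ℤ) = (N : ℤ) - 1) ∧ (i = κ' → ((m : ℤ) + u' κ') % (N : ℤ) = (N : ℤ) - 1) ∧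
            (i = i → ((m : ℤ) + x i) % (N : ℤ) = (N : ℤ) - 1) ∧ (i = b → ((m : ℤ) + z b) % (N : ℤ) = (N : ℤ) - 1))
          = (Finset.range N).filter (fun m : ℕ => ((m : ℤ) + x i) % (N : ℤ) = (N : ℤ) - 1) := by
        ext m
        simp only [Finset.mem_filter, Finset.mem_range, true_implies]
        exact ⟨fun h => ⟨h.1, h.2.2.2.1⟩, fun h => ⟨h.1, fun e => absurd e hiκ, fun e => absurd e hiκ', h.2, fun e => absurd e hab⟩⟩
      rw [e]
      exact card_filter_range_emod_succ hN (x i)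
    by_cases hib : i = b
    · subst hib
      rw [if_pos (by simp)]
      have e : (Finset.range N).filter (fun m : ℕ =>
          (i = κ → ((m : ℤ)) % (N : ℤ) = (N : ℤ) - 1) ∧ (i = κ' → ((m : ℤ) + u' κ') % (N : ℤ) = (N : ℤ) - 1) ∧
            (i = a → ((m : ℤ) + x a) % (N : ℤ) = (N : ℤ) - 1) ∧ (i = i → ((m : ℤ) + z i) % (N : ℤ) = (N : ℤ) - 1))
          = (Finset.range N).filter (fun m : ℕ => ((m : ℤ) + z i) % (N : ℤ) = (N : ℤ) - 1) := by
        ext m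
        simp only [Finset.mem_filter, Finset.mem_range, true_implies]
        exact ⟨fun h => ⟨h.1, h.2.2.2.2⟩, fun h => ⟨h.1, fun e => absurd e hiκ, fun e => absurd e hiκ', fun e => absurd e hia, h.2⟩⟩
      rw [e]
      exact card_filter_range_emod_succ hN (z i)
    · rw [if_neg (by simp [hiκ, hiκ', hia, hib])]
      have e : (Finset.range N).filter (fun m : ℕ =>
          (i = κ → ((m : ℤ)) % (N : ℤ) = (N : ℤ) - 1) ∧ (i = κ' → ((m : ℤ) + u' κ') % (N : ℤ) = (N : ℤ) - 1) ∧
            (i = a → ((m : ℤ) + x a) % (N : ℤ) = (N : ℤ) - 1) ∧ (i = b → ((m : ℤ) + z b) % (N : ℤ) = (N : ℤ) - 1)) = Finset.range N := by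
        refine Finset.filter_true_of_mem fun m _ => ?_
        exact ⟨fun e => absurd e hiκ, fun e => absurd e hiκ', fun e => absurd e hia, fun e => absurd e hib⟩
      rw [e, Finset.card_range]
  simp_rw [hcoord]
  rw [Finset.prod_ite, Finset.prod_const_one, one_mul, Finset.prod_const]
  congr 1
  -- the free coordinates: `(d+1) − 4`
  have hS : (({κ, κ', a, b} : Finset (Fin (d + 1)))).card = 4 := by
    rw [Finset.card_insert_of_notMem (by simp [hκκ', hκa, hκb]), Finset.card_insert_of_notMem (by simp [hκ'a, hκ'b]),
      Finset.card_pair hab]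
  rw [Finset.filter_not, Finset.card_sdiff_of_subset (Finset.filter_subset _ _), Finset.card_univ, Fintype.card_fin,
    Finset.filter_mem_eq_inter, Finset.univ_inter, hS]

/-! ## §3 On pairwise-distinct patterns the four-face charge is `N^{−4}` of the cell charge -/

/-- NOT IN PRINT; OUR BOOKKEEPING.  **ON A PAIRWISE-DISTINCT DIRECTION PATTERN, `N⁴ · fourFace_N (Y) = zmode N Y`** for every unit-covariant `LocStencil₂`
table (`0 < δ`, `1 ≤ N`, `3 ≤ d` is forced by four distinct directions): the count of §2 is the constant `N^{d−3}`, the slice charge at the origin is the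
constant slice charge (leaf-16's `ZeroModeCoarseCount.inner_const_of_unit_cov`), and `N⁴·N^{d−3}·slice = N^{d+1}·slice = zmode N Y` (`card_box`). -/
theorem fourFace_mul_eq_zmode_of_pairwise_ne (hN : 1 ≤ N) (hd : 3 ≤ d) {Y : Tab d} {C δ : ℝ} (hY : LocStencil₂ Y C δ) (hδ : 0 < δ)
    (h1 : ∀ κ u κ' u' t, Y κ (u + t) κ' (u' + t) = shiftK (-t) (Y κ u κ' u')) {κ κ' a b : Fin (d + 1)} (hκκ' : κ ≠ κ') (hκa : κ ≠ a)
    (hκb : κ ≠ b) (hκ'a : κ' ≠ a) (hκ'b : κ' ≠ b) (hab : a ≠ b) (a' b' : Fib d) :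
    (N : ℝ) ^ 4 * ∑ rr ∈ box (d + 1) N, ∑' u' : Site (d + 1), ∑' x : Site (d + 1), ∑' z : Site (d + 1),
        (if toSite rr κ % (N : ℤ) = (N : ℤ) - 1 ∧ u' κ' % (N : ℤ) = (N : ℤ) - 1 ∧ x a % (N : ℤ) = (N : ℤ) - 1 ∧ z b % (N : ℤ) = (N : ℤ) - 1
          then Y κ (toSite rr) κ' u' x z a' b' else 0)
      = zmode N Y κ κ' a' b' := by
  rw [fourFace_eq_card_weighted N hY hδ h1 κ κ' a b a' b']
  simp_rw [card_faceFilter_of_pairwise_ne hN hκκ' hκa hκb hκ'a hκ'b hab]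
  simp only [tsum_mul_left]
  -- the cell charge is `N^{d+1}` slices at the origin
  unfold zmode
  rw [Finset.sum_congr rfl fun rr _ => inner_const_of_unit_cov h1 κ κ' a' b' (toSite rr), Finset.sum_const, card_box, nsmul_eq_mul]
  push_cast
  have hpow : (N : ℝ) ^ 4 * (N : ℝ) ^ (d + 1 - 4) = (N : ℝ) ^ (d + 1) := by
    rw [← pow_add]
    congr 1
    omega
  have hpow' : (N : ℝ) ^ 4 * (N : ℝ) ^ (d - 3) = (N : ℝ) ^ (d + 1) := by
    rw [← pow_add]
    congr 1
    omega
  rw [← mul_assoc]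
  first
    | rw [hpow]
    | rw [hpow']

/-- NOT IN PRINT; OUR BOOKKEEPING.  **ON A PAIRWISE-DISTINCT PATTERN THE TABLE DRESSING `𝔇` PRESERVES THE FIELD–FIELD CELL CHARGE** of a unit-covariant
`LocStencil₂` table (in-block root `ρ = toSite r`, `1 ≤ N`, `3 ≤ d`): `zmode N (𝔇Y) κ κ′ (inl a) (inl b) = zmode N Y κ κ′ (inl a) (inl b)` whenever
`κ, κ′, a, b` are pairwise distinct (PART 2's `zmode_tableDress_ff` + §3).  At `d = 3` these are the 24 permutation patterns; the defect of (W3)(b) lives on the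
232 COINCIDENT patterns — where road W3's pin carries the charge. -/
theorem zmode_tableDress_eq_zmode_of_pairwise_ne (hN : 1 ≤ N) (hr : r ∈ box (d + 1) N) (hd : 3 ≤ d) {Y : Tab d} {C δ : ℝ}
    (hY : LocStencil₂ Y C δ) (hδ : 0 < δ) (h1 : ∀ κ u κ' u' t, Y κ (u + t) κ' (u' + t) = shiftK (-t) (Y κ u κ' u'))
    {κ κ' a b : Fin (d + 1)} (hκκ' : κ ≠ κ') (hκa : κ ≠ a) (hκb : κ ≠ b) (hκ'a : κ' ≠ a) (hκ'b : κ' ≠ b) (hab : a ≠ b) :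
    zmode N (fun κ u κ' u' => dressKBmAt (toSite r) N
        (coProjBmAtK (toSite r) N (fun κ₁ u₁ => coProjBmAtK (toSite r) N (Y κ₁ u₁) κ' u') κ u)) κ κ' (Sum.inl a) (Sum.inl b)
      = zmode N Y κ κ' (Sum.inl a) (Sum.inl b) := by
  have hcov : ∀ κ u κ' u' t, Y κ (u + (N : ℤ) • t) κ' (u' + (N : ℤ) • t) = shiftK (-((N : ℤ) • t)) (Y κ u κ' u') :=
    fun κ u κ' u' t => h1 κ u κ' u' ((N : ℤ) • t)
  rw [zmode_tableDress_ff hN hr hY hδ hcov κ κ' a b]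
  exact fourFace_mul_eq_zmode_of_pairwise_ne hN hd hY hδ h1 hκκ' hκa hκb hκ'a hκ'b hab (Sum.inl a) (Sum.inl b)

end Summit.QuantumFields.BalabanUV.Beta.GAN24.FourFaceOneCov

end
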